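import Literature.ModelTheory.ExponentialFields.OEFDefinablyCompleteZeros
import Literature.ModelTheory.ExponentialFields.DefinableBaireCodes
import HarnessLib

/-!
# The recursive subtheory `OEFDCB = OEF ∪ [DC] ∪ [Baire]` of `Th(ℝ_exp)`

Topic `Literature/ModelTheory/ExponentialFields`.  The axioms of Fornasiero–Servi's Corollary
8.3 (*Definably complete Baire structures*, Fund. Math. 209 (2010): "the following statements
axiomatize a recursive subtheory of `Th(ℝ_exp)` which is o-minimal: Axioms of ordered field;
Axioms ensuring that the models are definably complete and Baire;
`∀x exp'(x) = exp(x) ∧ exp(0) = 1`") and of the schemes `[OF] + [DCB] + [DE]` of Jones–Servi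
(J. Symbolic Logic 76 (2011), Def. 1.2), in the tree's vocabulary: the finite true theory
`Theory.OEF` of ordered exponential fields (`OrderedExpFieldModels.lean`; its functional equation
and `x + 1 ≤ exp x` force `exp' = exp`, `DefinablyCompleteExp.lean`), the definable completeness
scheme (`DefinableCompleteness.lean`, recursive by `DefinableCompletenessCodes.lean`) and the
Baire scheme (`DefinableBaire.lean`, recursive by `DefinableBaireCodes.lean`).  This file names
the union `Theory.OEFDCB` and records: `OEFDCB ⊆ Th(ℝ_exp)`, `OEFDCB` is recursive,
`ℝ_exp ⊨ OEFDCB`, and every model of `OEFDCB` is a definably complete, definably Baire ordered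
exponential field — the setting of Fornasiero–Servi's o-minimality theorem (Theorem 8.2 /
Cor. 8.3), towards a recursive `T₀ ⊆ Th(ℝ_exp)` as in `macintyreWilkie_recursiveSubtheory`.

Everything is proved; the only definition is the name `Theory.OEFDCB`.  No named facts.

## References

* A. Fornasiero, T. Servi, *Definably complete Baire structures*, Fund. Math. 209 (2010),
  Remark 2.10, Theorem 8.2, Corollary 8.3. [FornasieroServi2010]
* G. O. Jones, T. Servi, *On the decidability of the real field with a generic power function*,
  J. Symbolic Logic 76 (2011), Def. 1.2. [JonesServi2011]
-/

noncomputable section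

open Set FirstOrder FirstOrder.Language

namespace Literature.ModelTheory.ExponentialFields

universe w

/-- **`OEFDCB = OEF ∪ [DC] ∪ [Baire]`**: ordered exponential field axioms, the definable
completeness scheme and the Baire scheme — the axioms of Fornasiero–Servi 2010, Cor. 8.3
("Axioms of ordered field. Axioms ensuring that the models are definably complete and Baire.
`exp' = exp`, `exp 0 = 1`") in the tree's vocabulary.  A definition (a name for a set of true
sentences). [cite: FornasieroServi2010, Cor. 8.3] -/
def Theory.OEFDCB : Language.orderedExpRing.Theory :=
  Theory.OEFDC ∪ DefinableBaire.scheme Language.orderedExpRing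

/-- `OEFDCB ⊆ Th(ℝ_exp)`. [cite: FornasieroServi2010, Cor. 8.3] -/
theorem OEFDCB_subset_realExpTheory : Theory.OEFDCB ⊆ realExpTheory :=
  Set.union_subset OEFDC_subset_realExpTheory DefinableBaire.scheme_subset_realExpTheory

/-- **`OEFDCB` is recursive** (Fornasiero–Servi 2010, Remark 2.10 and Cor. 8.3: "a recursive
subtheory of `Th(ℝ_exp)`"). [cite: FornasieroServi2010, Cor. 8.3] -/
theorem OEFDCB_isRecursive : Theory.OEFDCB.IsRecursive :=
  OEFDC_isRecursive.union DefinableBaire.isRecursive_scheme_orderedExpRing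

/-- `OEFDC ⊆ OEFDCB`. [folklore] -/
theorem OEFDC_subset_OEFDCB : Theory.OEFDC ⊆ Theory.OEFDCB := Set.subset_union_left

/-- `OEF ⊆ OEFDCB`. [folklore] -/
theorem OEF_subset_OEFDCB : Theory.OEF ⊆ Theory.OEFDCB :=
  Set.subset_union_left.trans OEFDC_subset_OEFDCB

/-- `OEFDCB` proves `OEF`. [folklore] -/
theorem modelsOEF_OEFDCB : Theory.ModelsOEF Theory.OEFDCB :=
  modelsOEF_of_subset OEF_subset_OEFDCB

/-- `ℝ_exp ⊨ OEFDCB`. [cite: FornasieroServi2010, Examples 2.11] -/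
instance Real.model_OEFDCB : ℝ ⊨ Theory.OEFDCB :=
  ⟨fun _ hσ => Language.Theory.realize_sentence_of_mem realExpTheory
    (OEFDCB_subset_realExpTheory hσ)⟩

namespace OEFDCBModel

variable (M : Language.Theory.ModelType.{0, 0, w} Theory.OEFDCB)

/-- A model of `OEFDCB` as a model of `OEF` with the same carrier and structure, so that
`OEFModel`'s field structure, order and `exp` apply. [folklore] -/
abbrev toOEF : Language.Theory.ModelType.{0, 0, w} Theory.OEF :=
  Theory.ModelType.toOEFModel modelsOEF_OEFDCB M

/-- A model of `OEFDCB` satisfies the scheme `[DC]`. [folklore] -/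
instance model_definableCompletenessScheme :
    (toOEF M : Type w) ⊨ DefinableCompleteness.scheme Language.orderedExpRing :=
  (show (toOEF M : Type w) ⊨ Theory.OEFDCB from M.is_model).mono
    (Set.subset_union_right.trans OEFDC_subset_OEFDCB)

/-- A model of `OEFDCB` satisfies the Baire scheme. [folklore] -/
instance model_definableBaireScheme :
    (toOEF M : Type w) ⊨ DefinableBaire.scheme Language.orderedExpRing :=
  (show (toOEF M : Type w) ⊨ Theory.OEFDCB from M.is_model).mono Set.subset_union_right

/-- **Every model of `OEFDCB` is definably complete.** [cite: FornasieroServi2010, Def. 1.5] -/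
theorem isDefinablyComplete : Language.orderedExpRing.IsDefinablyComplete (toOEF M) :=
  OEFModel.isDefinablyComplete_of_model_scheme (toOEF M)

/-- **Every model of `OEFDCB` is definably Baire** (for its order topology).
[cite: FornasieroServi2010, Def. 2.9] -/
theorem isDefinablyBaire [TopologicalSpace (toOEF M)] [OrderTopology (toOEF M)] :
    Language.orderedExpRing.IsDefinablyBaire (toOEF M) :=
  DefinableBaire.isDefinablyBaire_of_model

/-- In every model of `OEFDCB` the exponential satisfies the differential equation of
Fornasiero–Servi's third axiom, `exp' = exp` (the field derivative, `DefinablyCompleteExp.lean`: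
forced by `exp (x + y) = exp x · exp y` and `x + 1 ≤ exp x`). [cite: FornasieroServi2010, Cor. 8.3] -/
theorem hasFieldDerivAt_exp [TopologicalSpace (toOEF M)] [OrderTopology (toOEF M)] (x : toOEF M) :
    HasFieldDerivAt (OEFModel.exp : toOEF M → toOEF M) (OEFModel.exp x) x :=
  (OEFModel.isOrderedExp_exp (K := toOEF M)).hasFieldDerivAt x

/-- … and `exp 0 = 1`. [cite: FornasieroServi2010, Cor. 8.3] -/
theorem exp_zero : OEFModel.exp (0 : toOEF M) = 1 := OEFModel.exp_zero

end OEFDCBModel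

/-- **`OEFDCB` is a recursive subtheory of `Th(ℝ_exp)` containing `OEF` all of whose models are
definably complete and definably Baire** — the axiom system of Fornasiero–Servi 2010, Cor. 8.3,
whose models are o-minimal by their Theorem 8.2 (not proved here). [cite: FornasieroServi2010, Cor. 8.3] -/
theorem OEFDCB_recursive_subtheory :
    Theory.OEFDCB ⊆ realExpTheory ∧ Theory.OEFDCB.IsRecursive ∧ Theory.OEF ⊆ Theory.OEFDCB ∧
      (∀ (N : Type) [Language.orderedExpRing.Structure N] [LE N]
        [Language.orderedExpRing.OrderedStructure N], N ⊨ Theory.OEFDCB →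
          Language.orderedExpRing.IsDefinablyComplete N) ∧
      ∀ (N : Type) [Language.orderedExpRing.Structure N] [LinearOrder N] [DenselyOrdered N]
        [NoMinOrder N] [NoMaxOrder N] [TopologicalSpace N] [OrderTopology N]
        [Language.orderedExpRing.OrderedStructure N], N ⊨ Theory.OEFDCB →
          Language.orderedExpRing.IsDefinablyBaire N :=
  ⟨OEFDCB_subset_realExpTheory, OEFDCB_isRecursive, OEF_subset_OEFDCB,
    fun _ _ _ _ hN => DefinableCompleteness.model_scheme_iff_isDefinablyComplete.1
      (hN.mono (Set.subset_union_right.trans OEFDC_subset_OEFDCB)),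
    fun _ _ _ _ _ _ _ _ _ hN => DefinableBaire.model_scheme_iff_isDefinablyBaire.1
      (hN.mono Set.subset_union_right)⟩

end Literature.ModelTheory.ExponentialFields
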